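import Summits.KontsevichZagierPeriods.Zeta5Search.Barrier.ConeGammaTranslateGradientLocal

/-!
# ζ(5) search — BARRIER: THE SIGNED JUMP MASSES ARE THE GRADIENT OF THE TRANSLATE INTEGRAL — `P` is affine at every
# generic translate, with an oriented integer gradient of zero sum (the static object of (TD_A))

HONEST FRAMING (cell `pub-zeta5`): systematic search; no irrationality claim unless kernel-certified. MODEL objects
under Brown–Zudilin's (28)+(30) accounting ([BZ22] = arXiv:2210.03391; (28) observed, not proved); nothing here is a
statement about `ζ(5)`, any `γ` of record, the cone's supremum (C2 OPEN) or the value / sign of any jump mass or of the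
translate integral at a named direction (DATA of the cell — the lane's `J_e` tables); NO cancellation is quantified; S-E /
(TD_A) stay CONJECTURED; records in print UNMOVED. Prover P2 g40 (item «THE SIGNED JUMP MASSES», file (2b); plan INBOX
2026-08-28 l.9814). Sources: `BARRIER-PLAN.md` §2b («`J_e` = net jump of `𝒩` across the hyperplane family of the form `e`
per period; `Σ_e J_e = 0` but not termwise»), lead/lit g27 `SE-DESK-NOTE.md` §3(i) («`D` is piecewise LINEAR on the cells of
an explicit hyperplane arrangement in `δ` (crossing points move linearly with `δ`)»).
SETTING. `a` with all 28 forms `h_k(a) > 0`, `T > 0` a period, `P(δ) = translateIntegral a T δ = ∫₀ᵀ 𝒩(u·s(a) + δ) du`. Along the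
translate by `δ` the form `k` crosses `z ∈ ℤ` at `s_{k,z} = (z − φ_k δ)/h_k(a)`; the crossings of one period are
`z ∈ S_k = (⌊φ_kδ⌋, ⌊φ_kδ⌋ + T·h_k]` (`mem_crossings_iff`). GENERICITY is a MARGIN `r > 0`, certificate-style (finitely many
inequalities on `δ`): distinct crossings have `|s_{k,z} − s_{k',z'}| ≥ r` (`hsep`), none lies within `r` of `0` (`hend`;
hence of `T`, `crossing_far_from_T`; and `r·h_k ≤ 1`, `r_mul_h28_le_one`). With file (2a)'s jumps
`J_{k,z} = 𝒩(θ_{s_{k,z}}) − 𝒩(θ_{s_{k,z} − r/2})`, `θ_v = v·s(a) + δ`, and the PER-PERIOD SIGNED JUMP MASSES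
**`J_k(δ) = Σ_{z ∈ S_k} J_{k,z} ∈ ℤ`** (written out; no def):
* `torusN_sub_eq_sum_windows`, `integral_window_term` — for `|φ_k Δ| ≤ r·h_k/4` the response `𝒩(θ_u + Δ) − 𝒩(θ_u)` on `[0,T]`
  is the sum over the crossings of `J_{k,z}·(⌊y_k + φ_kΔ⌋ − ⌊y_k⌋)` on the disjoint windows `|u − s_{k,z}| < r/2 ⊂ (0,T)`,
  and each window integrates to `J_{k,z}·φ_k(Δ)/h_k(a)`;
* **`translateIntegral_sub_eq_sum_jumpMass` — THE GRADIENT THEOREM**: **`P(δ + Δ) − P(δ) = Σ_k (φ_k(Δ)/h_k(a))·J_k(δ)`** for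
  EVERY `Δ` with `|φ_k(Δ)| ≤ r·h_k(a)/4`: `P` is AFFINE there (`translateIntegral_symm_diff`: no kink — contrast the closed
  orbit, where `σ(Δ) + σ(−Δ)` is the cusp), its gradient the signed jump masses against the rates;
* **`sum_jumpMass_eq_zero` — `Σ_k J_k(δ) = 0`**: flow invariance (`translateIntegral_add_smul_sParam`) through the gradient at
  `Δ = (r/4)·s(a)` — §2b's «`Σ_e J_e = 0` but not termwise» as a THEOREM at every generic translate (at the closed orbit:
  P2 g33's `canonical_greedy_sum_eq_zero`, P2 g28's `sum_orbitJumps_eq_zero`);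
* **`jumpMass_bounds_of_FIdx` / `_of_not_FIdx`** — `0 ≤ J_k ≤ T·h_k(a)` on `F`, `−T·h_k(a) ≤ J_k ≤ 0` off `F` (every jump is
  `0/±1` with the wall orientation): `J(δ) ∈ ℤ²⁸` ranges over a FINITE box of oriented zero-sum integer vectors, so the (TD_A)
  defect `δ ↦ P(δ) − P(0)` is affine near every generic translate with one of finitely many slope vectors `(J_k/h_k(a))_k`
  (READING: P2 g33's chamber formula `σ(δ) = Σ_k W_k(δ₀)·φ_k(δ)/h_k` has the same shape at the closed orbit; the
  identification of `W_k(δ₀)` with a limit of `J_k` is NOT made here);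
* `abs_translateIntegral_sub_le_of_generic` — `|P(δ+Δ) − P(δ)| ≤ T·Σ_k|φ_k Δ|`: P2 g29's NO-CANCELLATION Lipschitz constant is
  the case of no cancellation among the `J_k`; S-E's constant is the SIZE of the `J_k` — DATA, in no statement.
NOT here (honest): a margin `r` for almost every `δ` (routine; a certificate checks its own `δ`); any value of `J_k`; `Φ`,
`γ`, C2, S-E's truth, `ζ(5)`.
-/

noncomputable section

open Set MeasureTheory
open scoped Topology

namespace Summit.KontsevichZagierPeriods.Zeta5Search.Barrier.ConeGamma

/-! ### Consequences of the margin -/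

/-- Separated crossings of ONE form are `1/h_k` apart, so `r·h_k(a) ≤ 1`. -/
theorem r_mul_h28_le_one {a : Dir} (hpos : ∀ k, 0 < h28 a k) {δ : Fin 8 → ℝ} {r : ℝ}
    (hsep : ∀ (k k' : Fin 28) (z z' : ℤ), (k ≠ k' ∨ z ≠ z') →
      r ≤ |((z : ℝ) - phiForm δ k) / h28 a k - ((z' : ℝ) - phiForm δ k') / h28 a k'|) (k : Fin 28) :
    r * h28 a k ≤ 1 := by
  have hx := hpos k
  have h := hsep k k 0 1 (Or.inr zero_ne_one)
  rw [show ((0 : ℤ) : ℝ) - phiForm δ k = -phiForm δ k by simp, show (((1 : ℤ) : ℝ) - phiForm δ k) / h28 a k =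
    (-phiForm δ k) / h28 a k + 1 / h28 a k by push_cast; ring, show -phiForm δ k / h28 a k -
    (-phiForm δ k / h28 a k + 1 / h28 a k) = -(1 / h28 a k) by ring, abs_neg, abs_of_pos (by positivity)] at h
  calc r * h28 a k ≤ 1 / h28 a k * h28 a k := mul_le_mul_of_nonneg_right h hx.le
    _ = 1 := by field_simp

/-- **No crossing within `r` of `T`** (periodicity: `s_{k,z} − T = s_{k,z−N_k}` with `N_k = T·h_k ∈ ℤ`). -/
theorem crossing_far_from_T {a : Dir} (hpos : ∀ k, 0 < h28 a k) {T : ℝ}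
    (hper : ∀ k : Fin 28, ∃ z : ℤ, T * h28 a k = z) {δ : Fin 8 → ℝ} {r : ℝ}
    (hend : ∀ (k : Fin 28) (z : ℤ), r ≤ |((z : ℝ) - phiForm δ k) / h28 a k|) (k : Fin 28) (z : ℤ) :
    r ≤ |((z : ℝ) - phiForm δ k) / h28 a k - T| := by
  obtain ⟨N, hN⟩ := hper k
  have hx := hpos k
  have e : ((z : ℝ) - phiForm δ k) / h28 a k - T = (((z - N : ℤ) : ℝ) - phiForm δ k) / h28 a k := by
    push_cast; field_simp; linarith
  rw [e]; exact hend k (z - N)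

/-- **The crossings of one period.** For `z ∈ ℤ`: `0 < s_{k,z} < T` iff `z ∈ (⌊φ_kδ⌋, ⌊φ_kδ⌋ + ⌊T·h_k⌋]` (the margin at
`0` makes `φ_k δ ∉ ℤ`; `T·h_k ∈ ℤ`). -/
theorem mem_crossings_iff {a : Dir} (hpos : ∀ k, 0 < h28 a k) {T : ℝ}
    (hper : ∀ k : Fin 28, ∃ z : ℤ, T * h28 a k = z) {δ : Fin 8 → ℝ} {r : ℝ} (hr : 0 < r)
    (hend : ∀ (k : Fin 28) (z : ℤ), r ≤ |((z : ℝ) - phiForm δ k) / h28 a k|) (k : Fin 28) (z : ℤ) :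
    z ∈ Finset.Ioc ⌊phiForm δ k⌋ (⌊phiForm δ k⌋ + ⌊T * h28 a k⌋) ↔
      0 < ((z : ℝ) - phiForm δ k) / h28 a k ∧ ((z : ℝ) - phiForm δ k) / h28 a k < T := by
  obtain ⟨N, hN⟩ := hper k
  have hx := hpos k
  have hNf : ⌊T * h28 a k⌋ = N := by rw [hN, Int.floor_intCast]
  have hnot : ∀ w : ℤ, (w : ℝ) ≠ phiForm δ k := by
    intro w hw
    have h := hend k w
    rw [hw, sub_self, zero_div, abs_zero] at h
    exact absurd h (not_le.mpr hr)
  rw [Finset.mem_Ioc, hNf, div_pos_iff_of_pos_right hx, sub_pos, div_lt_iff₀ hx, hN, Int.floor_lt]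
  constructor
  · rintro ⟨h1, h2⟩
    refine ⟨h1, ?_⟩
    have h3 : ((z - N : ℤ) : ℝ) ≤ phiForm δ k := Int.le_floor.mp (by omega)
    have h4 : ((z - N : ℤ) : ℝ) ≠ phiForm δ k := hnot _
    push_cast at h3 h4
    have := lt_of_le_of_ne h3 h4
    linarith
  · rintro ⟨h1, h2⟩
    refine ⟨h1, ?_⟩
    have h3 : ((z - N : ℤ) : ℝ) ≤ phiForm δ k := by push_cast; linarith
    have := Int.le_floor.mpr h3
    omega

/-! ### The response of the saving, pointwise on the period, as a sum over the crossings -/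

/-- **THE RESPONSE IS A SUM OVER THE WINDOWS.** With the margin hypotheses, for `u ∈ [0, T]` and `|φ_k Δ| ≤ r·h_k/4`:
`𝒩(θ_u + Δ) − 𝒩(θ_u) = Σ_k Σ_{z∈S_k} [|u − s_{k,z}| < r/2]·J_{k,z}·(⌊u·h_k + φ_kδ + φ_kΔ⌋ − ⌊u·h_k + φ_kδ⌋)`. -/
theorem torusN_sub_eq_sum_windows {a : Dir} (hpos : ∀ k, 0 < h28 a k) {T : ℝ}
    (hper : ∀ k : Fin 28, ∃ z : ℤ, T * h28 a k = z) {δ : Fin 8 → ℝ} {r : ℝ} (hr : 0 < r)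
    (hsep : ∀ (k k' : Fin 28) (z z' : ℤ), (k ≠ k' ∨ z ≠ z') →
      r ≤ |((z : ℝ) - phiForm δ k) / h28 a k - ((z' : ℝ) - phiForm δ k') / h28 a k'|)
    (hend : ∀ (k : Fin 28) (z : ℤ), r ≤ |((z : ℝ) - phiForm δ k) / h28 a k|)
    {Δ : Fin 8 → ℝ} (hΔ : ∀ k, |phiForm Δ k| ≤ r * h28 a k / 4) {u : ℝ} (hu : u ∈ Icc 0 T) :
    ((torusN (u • sParam a + (δ + Δ)) : ℤ) : ℝ) - torusN (u • sParam a + δ) =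
      ∑ k : Fin 28, ∑ z ∈ Finset.Ioc ⌊phiForm δ k⌋ (⌊phiForm δ k⌋ + ⌊T * h28 a k⌋),
        if |u - ((z : ℝ) - phiForm δ k) / h28 a k| < r / 2 then
          ((torusN ((((z : ℝ) - phiForm δ k) / h28 a k) • sParam a + δ) -
              torusN ((((z : ℝ) - phiForm δ k) / h28 a k - r / 2) • sParam a + δ) : ℤ) : ℝ) *
            ((⌊u * h28 a k + phiForm δ k + phiForm Δ k⌋ : ℝ) - ⌊u * h28 a k + phiForm δ k⌋)
        else 0 := by
  rw [← add_assoc]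
  by_cases hex : ∃ (k : Fin 28) (z : ℤ), |u - ((z : ℝ) - phiForm δ k) / h28 a k| < r / 2
  · obtain ⟨k₀, z₀, h₀⟩ := hex
    set s₀ := ((z₀ : ℝ) - phiForm δ k₀) / h28 a k₀ with hs₀def
    -- the crossing is inside the period
    have hz₀ : z₀ ∈ Finset.Ioc ⌊phiForm δ k₀⌋ (⌊phiForm δ k₀⌋ + ⌊T * h28 a k₀⌋) := by
      rw [mem_crossings_iff hpos hper hr hend]
      have h1 := hend k₀ z₀
      have h2 := crossing_far_from_T hpos hper hend k₀ z₀
      have hu' := abs_lt.mp h₀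
      refine ⟨?_, ?_⟩
      · by_contra hle
        push Not at hle
        rw [abs_of_nonpos hle] at h1
        linarith [hu.1]
      · by_contra hle
        push Not at hle
        rw [abs_of_nonneg (by linarith)] at h2
        linarith [hu.2]
    -- every other window misses `u`
    have hmiss : ∀ (k : Fin 28) (z : ℤ), (k ≠ k₀ ∨ z ≠ z₀) →
        ¬ |u - ((z : ℝ) - phiForm δ k) / h28 a k| < r / 2 := by
      intro k z hne hlt
      have h := hsep k₀ k z₀ z (by tauto)
      have := abs_sub_le s₀ u (((z : ℝ) - phiForm δ k) / h28 a k)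
      rw [abs_sub_comm s₀ u] at this
      linarith
    rw [Finset.sum_eq_single k₀ (fun k _ hk => Finset.sum_eq_zero fun z _ => if_neg (hmiss k z (Or.inl hk)))
      (fun h => absurd (Finset.mem_univ k₀) h),
      Finset.sum_eq_single z₀ (fun z _ hz => if_neg (hmiss k₀ z (Or.inr hz))) (fun h => absurd hz₀ h), if_pos h₀]
    exact torusN_sub_near_crossing hpos hr (r_mul_h28_le_one hpos hsep k₀)
      (fun k z hk => hsep k₀ k z₀ z (Or.inl (Ne.symm hk))) h₀.le hΔ
  · push Not at hex
    rw [torusN_add_eq_of_far hpos hr hex hΔ, sub_self]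
    symm
    exact Finset.sum_eq_zero fun k _ => Finset.sum_eq_zero fun z _ => if_neg (not_lt.mpr (hex k z))

/-! ### One window integrates to `J_{k,z}·φ_k(Δ)/h_k(a)` -/

/-- The window term is integrable on `[0, T]`. -/
theorem intervalIntegrable_window_term (x c e s₀ ρ J α β : ℝ) (hx : 0 ≤ x) :
    IntervalIntegrable (fun u : ℝ => if |u - s₀| < ρ then J * ((⌊u * x + c + e⌋ : ℝ) - ⌊u * x + c⌋) else 0)
      volume α β := by
  have hf : IntervalIntegrable (fun u : ℝ => J * ((⌊u * x + c + e⌋ : ℝ) - ⌊u * x + c⌋)) volume α β :=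
    (((intervalIntegrable_floor_line hx (c + e) α β).congr fun u _ => by simp only [add_assoc]).sub
      (intervalIntegrable_floor_line hx c α β)).const_mul J
  have heq : (fun u : ℝ => if |u - s₀| < ρ then J * ((⌊u * x + c + e⌋ : ℝ) - ⌊u * x + c⌋) else 0) =
      (Ioo (s₀ - ρ) (s₀ + ρ)).indicator fun u => J * ((⌊u * x + c + e⌋ : ℝ) - ⌊u * x + c⌋) := by
    funext u
    by_cases h : |u - s₀| < ρ
    · have hm : u ∈ Ioo (s₀ - ρ) (s₀ + ρ) := by
        rw [abs_sub_lt_iff] at h; exact ⟨by linarith [h.2], by linarith [h.1]⟩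
      rw [if_pos h, Set.indicator_of_mem hm]
    · have hm : u ∉ Ioo (s₀ - ρ) (s₀ + ρ) := by
        intro hm; exact h (abs_sub_lt_iff.mpr ⟨by linarith [hm.2], by linarith [hm.1]⟩)
      rw [if_neg h, Set.indicator_of_notMem hm]
  rw [heq]
  rw [intervalIntegrable_iff] at hf ⊢
  exact hf.indicator measurableSet_Ioo

/-- **ONE WINDOW.** For a crossing `(k, z)` of the period (so `r ≤ s_{k,z} ≤ T − r`):
`∫₀ᵀ [|u − s_{k,z}| < r/2]·J·(⌊u·h_k + φ_kδ + e⌋ − ⌊u·h_k + φ_kδ⌋) du = J·e/h_k(a)` for `|e| ≤ r·h_k/4` (`r·h_k ≤ 1`). -/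
theorem integral_window_term {a : Dir} (hpos : ∀ k, 0 < h28 a k) {T : ℝ} (hT : 0 < T) {δ : Fin 8 → ℝ} {r : ℝ}
    (hr : 0 < r) (k : Fin 28) (z : ℤ) (hr1 : r * h28 a k ≤ 1)
    (h0 : r ≤ ((z : ℝ) - phiForm δ k) / h28 a k) (hT' : ((z : ℝ) - phiForm δ k) / h28 a k ≤ T - r)
    (J : ℝ) {e : ℝ} (he : |e| ≤ r * h28 a k / 4) :
    ∫ u in (0 : ℝ)..T, (if |u - ((z : ℝ) - phiForm δ k) / h28 a k| < r / 2 then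
        J * ((⌊u * h28 a k + phiForm δ k + e⌋ : ℝ) - ⌊u * h28 a k + phiForm δ k⌋) else 0) = J * (e / h28 a k) := by
  set s₀ := ((z : ℝ) - phiForm δ k) / h28 a k with hs₀def
  have hx := hpos k
  set f : ℝ → ℝ := fun u => J * ((⌊u * h28 a k + phiForm δ k + e⌋ : ℝ) - ⌊u * h28 a k + phiForm δ k⌋) with hf
  have e1 : (fun u : ℝ => if |u - s₀| < r / 2 then
      J * ((⌊u * h28 a k + phiForm δ k + e⌋ : ℝ) - ⌊u * h28 a k + phiForm δ k⌋) else 0) =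
      (Ioo (s₀ - r / 2) (s₀ + r / 2)).indicator f := by
    funext u
    by_cases h : |u - s₀| < r / 2
    · have hm : u ∈ Ioo (s₀ - r / 2) (s₀ + r / 2) := by
        rw [abs_sub_lt_iff] at h; exact ⟨by linarith [h.2], by linarith [h.1]⟩
      rw [if_pos h, Set.indicator_of_mem hm]
    · have hm : u ∉ Ioo (s₀ - r / 2) (s₀ + r / 2) := by
        intro hm; exact h (abs_sub_lt_iff.mpr ⟨by linarith [hm.2], by linarith [hm.1]⟩)
      rw [if_neg h, Set.indicator_of_notMem hm]
  have hsub : Ioo (s₀ - r / 2) (s₀ + r / 2) ⊆ Ioc 0 T := fun u hu => ⟨by linarith [hu.1], by linarith [hu.2]⟩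
  have hle : s₀ - r / 2 ≤ s₀ + r / 2 := by linarith
  rw [e1, intervalIntegral.integral_of_le hT.le, setIntegral_indicator measurableSet_Ioo,
    Set.inter_eq_self_of_subset_right hsub, ← integral_Ioc_eq_integral_Ioo, ← intervalIntegral.integral_of_le hle, hf,
    intervalIntegral.integral_const_mul]
  congr 1
  have hs₀ : s₀ * h28 a k + phiForm δ k = z := by rw [hs₀def, div_mul_cancel₀ _ hx.ne']; ring
  exact integral_floor_line_shift_window hx hs₀ (by nlinarith) (by nlinarith [abs_nonneg e])

/-! ### THE GRADIENT THEOREM -/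

/-- **THE SIGNED JUMP MASSES ARE THE GRADIENT OF THE TRANSLATE INTEGRAL.** Let all 28 forms of `a` be positive, `T > 0`
a period, and let the translate `δ` be generic with margin `r > 0`: distinct crossings `(k,z) ≠ (k',z')` have crossing
times `s_{k,z} = (z − φ_kδ)/h_k(a)` at least `r` apart, and none lies within `r` of `0`. Then for EVERY displacement `Δ`
with `|φ_k(Δ)| ≤ r·h_k(a)/4` for all `k`:
`P(δ + Δ) − P(δ) = Σ_k (φ_k(Δ)/h_k(a)) · J_k(δ)`, `J_k(δ) = Σ_{z ∈ (⌊φ_kδ⌋, ⌊φ_kδ⌋ + T·h_k]} (𝒩(θ_{s_{k,z}}) − 𝒩(θ_{s_{k,z} − r/2}))`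
— the per-period signed jump mass of the form `k` along the translated orbit. `P` is AFFINE near `δ`. -/
theorem translateIntegral_sub_eq_sum_jumpMass {a : Dir} (hpos : ∀ k, 0 < h28 a k) {T : ℝ} (hT : 0 < T)
    (hper : ∀ k : Fin 28, ∃ z : ℤ, T * h28 a k = z) {δ : Fin 8 → ℝ} {r : ℝ} (hr : 0 < r)
    (hsep : ∀ (k k' : Fin 28) (z z' : ℤ), (k ≠ k' ∨ z ≠ z') →
      r ≤ |((z : ℝ) - phiForm δ k) / h28 a k - ((z' : ℝ) - phiForm δ k') / h28 a k'|)
    (hend : ∀ (k : Fin 28) (z : ℤ), r ≤ |((z : ℝ) - phiForm δ k) / h28 a k|)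
    {Δ : Fin 8 → ℝ} (hΔ : ∀ k, |phiForm Δ k| ≤ r * h28 a k / 4) :
    translateIntegral a T (δ + Δ) - translateIntegral a T δ =
      ∑ k : Fin 28, phiForm Δ k / h28 a k *
        ((∑ z ∈ Finset.Ioc ⌊phiForm δ k⌋ (⌊phiForm δ k⌋ + ⌊T * h28 a k⌋),
          (torusN ((((z : ℝ) - phiForm δ k) / h28 a k) • sParam a + δ) -
            torusN ((((z : ℝ) - phiForm δ k) / h28 a k - r / 2) • sParam a + δ)) : ℤ) : ℝ) := by
  rw [translateIntegral_sub]
  have hint : ∀ k ∈ (Finset.univ : Finset (Fin 28)), IntervalIntegrable (fun u : ℝ =>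
      ∑ z ∈ Finset.Ioc ⌊phiForm δ k⌋ (⌊phiForm δ k⌋ + ⌊T * h28 a k⌋),
        (if |u - ((z : ℝ) - phiForm δ k) / h28 a k| < r / 2 then
          ((torusN ((((z : ℝ) - phiForm δ k) / h28 a k) • sParam a + δ) -
              torusN ((((z : ℝ) - phiForm δ k) / h28 a k - r / 2) • sParam a + δ) : ℤ) : ℝ) *
            ((⌊u * h28 a k + phiForm δ k + phiForm Δ k⌋ : ℝ) - ⌊u * h28 a k + phiForm δ k⌋)
        else 0)) volume 0 T := by
    intro k _
    have h := IntervalIntegrable.sum (μ := volume) (a := 0) (b := T)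
      (Finset.Ioc ⌊phiForm δ k⌋ (⌊phiForm δ k⌋ + ⌊T * h28 a k⌋))
      (f := fun (z : ℤ) (u : ℝ) => if |u - ((z : ℝ) - phiForm δ k) / h28 a k| < r / 2 then
          ((torusN ((((z : ℝ) - phiForm δ k) / h28 a k) • sParam a + δ) -
              torusN ((((z : ℝ) - phiForm δ k) / h28 a k - r / 2) • sParam a + δ) : ℤ) : ℝ) *
            ((⌊u * h28 a k + phiForm δ k + phiForm Δ k⌋ : ℝ) - ⌊u * h28 a k + phiForm δ k⌋) else 0)
      fun z _ => intervalIntegrable_window_term _ _ _ _ _ _ _ _ (hpos k).le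
    refine h.congr fun u _ => ?_
    simp only [Finset.sum_apply]
  -- pointwise the response is the sum over the windows; integrate term by term
  rw [intervalIntegral.integral_congr fun u hu => torusN_sub_eq_sum_windows hpos hper hr hsep hend hΔ
    (by rwa [uIcc_of_le hT.le] at hu), intervalIntegral.integral_finsetSum hint]
  refine Finset.sum_congr rfl fun k _ => ?_
  rw [intervalIntegral.integral_finsetSum fun z _ => intervalIntegrable_window_term _ _ _ _ _ _ _ _ (hpos k).le]
  push_cast
  rw [Finset.mul_sum]
  refine Finset.sum_congr rfl fun z hz => ?_
  obtain ⟨h1, h2⟩ := (mem_crossings_iff hpos hper hr hend k z).mp hz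
  have h0 : r ≤ ((z : ℝ) - phiForm δ k) / h28 a k := by
    have h := hend k z; rwa [abs_of_pos h1] at h
  have hT' : ((z : ℝ) - phiForm δ k) / h28 a k ≤ T - r := by
    have h := crossing_far_from_T hpos hper hend k z; rw [abs_of_neg (by linarith)] at h; linarith
  rw [integral_window_term hpos hT hr k z (r_mul_h28_le_one hpos hsep k) h0 hT' _ (hΔ k)]
  ring

/-- **NO KINK AT A GENERIC TRANSLATE**: `P(δ + Δ) + P(δ − Δ) = 2·P(δ)` for `|φ_k Δ| ≤ r·h_k/4` (contrast the closed orbit,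
where `σ(Δ) + σ(−Δ)` is the symmetric vote of the cusp). -/
theorem translateIntegral_symm_diff {a : Dir} (hpos : ∀ k, 0 < h28 a k) {T : ℝ} (hT : 0 < T)
    (hper : ∀ k : Fin 28, ∃ z : ℤ, T * h28 a k = z) {δ : Fin 8 → ℝ} {r : ℝ} (hr : 0 < r)
    (hsep : ∀ (k k' : Fin 28) (z z' : ℤ), (k ≠ k' ∨ z ≠ z') →
      r ≤ |((z : ℝ) - phiForm δ k) / h28 a k - ((z' : ℝ) - phiForm δ k') / h28 a k'|)
    (hend : ∀ (k : Fin 28) (z : ℤ), r ≤ |((z : ℝ) - phiForm δ k) / h28 a k|)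
    {Δ : Fin 8 → ℝ} (hΔ : ∀ k, |phiForm Δ k| ≤ r * h28 a k / 4) :
    translateIntegral a T (δ + Δ) + translateIntegral a T (δ + -Δ) = 2 * translateIntegral a T δ := by
  have hΔ' : ∀ k, |phiForm (-Δ) k| ≤ r * h28 a k / 4 := fun k => by
    rw [show -Δ = (-1 : ℝ) • Δ by simp, phiForm_smul, abs_mul, abs_neg, abs_one, one_mul]; exact hΔ k
  have h1 := translateIntegral_sub_eq_sum_jumpMass hpos hT hper hr hsep hend hΔ
  have h2 := translateIntegral_sub_eq_sum_jumpMass hpos hT hper hr hsep hend hΔ'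
  have hneg : ∀ k, phiForm (-Δ) k = -phiForm Δ k := fun k => by
    rw [show -Δ = (-1 : ℝ) • Δ by simp, phiForm_smul]; ring
  simp only [hneg, neg_div, neg_mul, Finset.sum_neg_distrib] at h2
  linarith

/-! ### Zero sum, orientation, and the no-cancellation bound -/

/-- **THE PER-PERIOD SIGNED JUMP MASSES SUM TO ZERO** («`Σ_e J_e = 0`, but not termwise»): under the margin hypotheses,
`Σ_k J_k(δ) = 0` — flow invariance of `P` read through the gradient theorem at `Δ = (r/4)·s(a)`. -/
theorem sum_jumpMass_eq_zero {a : Dir} (hpos : ∀ k, 0 < h28 a k) {T : ℝ} (hT : 0 < T)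
    (hper : ∀ k : Fin 28, ∃ z : ℤ, T * h28 a k = z) {δ : Fin 8 → ℝ} {r : ℝ} (hr : 0 < r)
    (hsep : ∀ (k k' : Fin 28) (z z' : ℤ), (k ≠ k' ∨ z ≠ z') →
      r ≤ |((z : ℝ) - phiForm δ k) / h28 a k - ((z' : ℝ) - phiForm δ k') / h28 a k'|)
    (hend : ∀ (k : Fin 28) (z : ℤ), r ≤ |((z : ℝ) - phiForm δ k) / h28 a k|) :
    ∑ k : Fin 28, ∑ z ∈ Finset.Ioc ⌊phiForm δ k⌋ (⌊phiForm δ k⌋ + ⌊T * h28 a k⌋),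
      (torusN ((((z : ℝ) - phiForm δ k) / h28 a k) • sParam a + δ) -
        torusN ((((z : ℝ) - phiForm δ k) / h28 a k - r / 2) • sParam a + δ)) = 0 := by
  have hΔ : ∀ k, |phiForm ((r / 4) • sParam a) k| ≤ r * h28 a k / 4 := fun k => by
    rw [phiForm_smul_sParam, abs_of_pos (by have := hpos k; positivity)]; linarith
  have h := translateIntegral_sub_eq_sum_jumpMass hpos hT hper hr hsep hend hΔ
  rw [translateIntegral_add_smul_sParam hper, sub_self] at h
  have e : ∀ k : Fin 28, phiForm ((r / 4) • sParam a) k / h28 a k = r / 4 := fun k => by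
    rw [phiForm_smul_sParam]; field_simp [(hpos k).ne']
  simp only [e, ← Finset.mul_sum] at h
  have h' := (mul_eq_zero.mp h.symm).resolve_left (by positivity)
  exact_mod_cast h'

/-- **ORIENTATION AND SIZE, `F`-forms**: `0 ≤ J_k(δ) ≤ T·h_k(a)` for `k ∈ F` (each of the `T·h_k` jumps is `0` or `1`). -/
theorem jumpMass_bounds_of_FIdx {a : Dir} (hpos : ∀ k, 0 < h28 a k) {T : ℝ} (hT : 0 < T)
    (hper : ∀ k : Fin 28, ∃ z : ℤ, T * h28 a k = z) {δ : Fin 8 → ℝ} {r : ℝ} (hr : 0 < r)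
    (hsep : ∀ (k k' : Fin 28) (z z' : ℤ), (k ≠ k' ∨ z ≠ z') →
      r ≤ |((z : ℝ) - phiForm δ k) / h28 a k - ((z' : ℝ) - phiForm δ k') / h28 a k'|)
    {k : Fin 28} (hk : k ∈ FIdx) :
    0 ≤ ∑ z ∈ Finset.Ioc ⌊phiForm δ k⌋ (⌊phiForm δ k⌋ + ⌊T * h28 a k⌋),
        (torusN ((((z : ℝ) - phiForm δ k) / h28 a k) • sParam a + δ) -
          torusN ((((z : ℝ) - phiForm δ k) / h28 a k - r / 2) • sParam a + δ)) ∧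
      ((∑ z ∈ Finset.Ioc ⌊phiForm δ k⌋ (⌊phiForm δ k⌋ + ⌊T * h28 a k⌋),
        (torusN ((((z : ℝ) - phiForm δ k) / h28 a k) • sParam a + δ) -
          torusN ((((z : ℝ) - phiForm δ k) / h28 a k - r / 2) • sParam a + δ)) : ℤ) : ℝ) ≤ T * h28 a k := by
  have hJ : ∀ z : ℤ, 0 ≤ torusN ((((z : ℝ) - phiForm δ k) / h28 a k) • sParam a + δ) -
        torusN ((((z : ℝ) - phiForm δ k) / h28 a k - r / 2) • sParam a + δ) ∧
      torusN ((((z : ℝ) - phiForm δ k) / h28 a k) • sParam a + δ) -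
        torusN ((((z : ℝ) - phiForm δ k) / h28 a k - r / 2) • sParam a + δ) ≤ 1 := fun z =>
    jump_mem_of_FIdx hpos hr (r_mul_h28_le_one hpos hsep k) (fun k' z' hk' => hsep k k' z z' (Or.inl (Ne.symm hk'))) hk
  obtain ⟨N, hN⟩ := hper k
  have hNf : ⌊T * h28 a k⌋ = N := by rw [hN, Int.floor_intCast]
  have hN0 : 0 ≤ N := by
    have : (0 : ℝ) ≤ N := by rw [← hN]; have := hpos k; positivity
    exact_mod_cast this
  refine ⟨Finset.sum_nonneg fun z _ => (hJ z).1, ?_⟩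
  have h := Finset.sum_le_card_nsmul (Finset.Ioc ⌊phiForm δ k⌋ (⌊phiForm δ k⌋ + ⌊T * h28 a k⌋))
    (fun z : ℤ => torusN ((((z : ℝ) - phiForm δ k) / h28 a k) • sParam a + δ) -
      torusN ((((z : ℝ) - phiForm δ k) / h28 a k - r / 2) • sParam a + δ)) 1 fun z _ => (hJ z).2
  rw [hNf, Int.card_Ioc, show ⌊phiForm δ k⌋ + N - ⌊phiForm δ k⌋ = N by ring, nsmul_eq_mul, mul_one,
    Int.toNat_of_nonneg hN0] at h
  rw [hNf, hN]
  exact_mod_cast h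

/-- **ORIENTATION AND SIZE, `F^c`-forms**: `−T·h_k(a) ≤ J_k(δ) ≤ 0` for `k ∉ F` (each jump is `−1` or `0`). -/
theorem jumpMass_bounds_of_not_FIdx {a : Dir} (hpos : ∀ k, 0 < h28 a k) {T : ℝ} (hT : 0 < T)
    (hper : ∀ k : Fin 28, ∃ z : ℤ, T * h28 a k = z) {δ : Fin 8 → ℝ} {r : ℝ} (hr : 0 < r)
    (hsep : ∀ (k k' : Fin 28) (z z' : ℤ), (k ≠ k' ∨ z ≠ z') →
      r ≤ |((z : ℝ) - phiForm δ k) / h28 a k - ((z' : ℝ) - phiForm δ k') / h28 a k'|)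
    {k : Fin 28} (hk : k ∉ FIdx) :
    ∑ z ∈ Finset.Ioc ⌊phiForm δ k⌋ (⌊phiForm δ k⌋ + ⌊T * h28 a k⌋),
        (torusN ((((z : ℝ) - phiForm δ k) / h28 a k) • sParam a + δ) -
          torusN ((((z : ℝ) - phiForm δ k) / h28 a k - r / 2) • sParam a + δ)) ≤ 0 ∧
      -(T * h28 a k) ≤ ((∑ z ∈ Finset.Ioc ⌊phiForm δ k⌋ (⌊phiForm δ k⌋ + ⌊T * h28 a k⌋),
        (torusN ((((z : ℝ) - phiForm δ k) / h28 a k) • sParam a + δ) -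
          torusN ((((z : ℝ) - phiForm δ k) / h28 a k - r / 2) • sParam a + δ)) : ℤ) : ℝ) := by
  have hJ : ∀ z : ℤ, -1 ≤ torusN ((((z : ℝ) - phiForm δ k) / h28 a k) • sParam a + δ) -
        torusN ((((z : ℝ) - phiForm δ k) / h28 a k - r / 2) • sParam a + δ) ∧
      torusN ((((z : ℝ) - phiForm δ k) / h28 a k) • sParam a + δ) -
        torusN ((((z : ℝ) - phiForm δ k) / h28 a k - r / 2) • sParam a + δ) ≤ 0 := fun z =>
    jump_mem_of_not_FIdx hpos hr (r_mul_h28_le_one hpos hsep k) (fun k' z' hk' => hsep k k' z z' (Or.inl (Ne.symm hk')))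
      hk
  obtain ⟨N, hN⟩ := hper k
  have hNf : ⌊T * h28 a k⌋ = N := by rw [hN, Int.floor_intCast]
  have hN0 : 0 ≤ N := by
    have : (0 : ℝ) ≤ N := by rw [← hN]; have := hpos k; positivity
    exact_mod_cast this
  refine ⟨Finset.sum_nonpos fun z _ => (hJ z).2, ?_⟩
  have h := Finset.card_nsmul_le_sum (Finset.Ioc ⌊phiForm δ k⌋ (⌊phiForm δ k⌋ + ⌊T * h28 a k⌋))
    (fun z : ℤ => torusN ((((z : ℝ) - phiForm δ k) / h28 a k) • sParam a + δ) -
      torusN ((((z : ℝ) - phiForm δ k) / h28 a k - r / 2) • sParam a + δ)) (-1) fun z _ => (hJ z).1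
  rw [hNf, Int.card_Ioc, show ⌊phiForm δ k⌋ + N - ⌊phiForm δ k⌋ = N by ring, nsmul_eq_mul, mul_neg_one,
    Int.toNat_of_nonneg hN0] at h
  rw [hNf, hN]
  exact_mod_cast h

/-- **NO CANCELLATION RECOVERS THE LIPSCHITZ CONSTANT**: under the margin hypotheses, `|P(δ+Δ) − P(δ)| ≤ T·Σ_k |φ_k Δ|`
for `|φ_k Δ| ≤ r·h_k/4` — P2 g29's `abs_translateIntegral_sub_le` is exactly the gradient theorem with every `|J_k|` at
its maximum `T·h_k(a)`; anything better is CANCELLATION among the jumps (DATA, in no statement). -/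
theorem abs_translateIntegral_sub_le_of_generic {a : Dir} (hpos : ∀ k, 0 < h28 a k) {T : ℝ} (hT : 0 < T)
    (hper : ∀ k : Fin 28, ∃ z : ℤ, T * h28 a k = z) {δ : Fin 8 → ℝ} {r : ℝ} (hr : 0 < r)
    (hsep : ∀ (k k' : Fin 28) (z z' : ℤ), (k ≠ k' ∨ z ≠ z') →
      r ≤ |((z : ℝ) - phiForm δ k) / h28 a k - ((z' : ℝ) - phiForm δ k') / h28 a k'|)
    (hend : ∀ (k : Fin 28) (z : ℤ), r ≤ |((z : ℝ) - phiForm δ k) / h28 a k|)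
    {Δ : Fin 8 → ℝ} (hΔ : ∀ k, |phiForm Δ k| ≤ r * h28 a k / 4) :
    |translateIntegral a T (δ + Δ) - translateIntegral a T δ| ≤ T * ∑ k : Fin 28, |phiForm Δ k| := by
  rw [translateIntegral_sub_eq_sum_jumpMass hpos hT hper hr hsep hend hΔ, Finset.mul_sum]
  refine (Finset.abs_sum_le_sum_abs _ _).trans (Finset.sum_le_sum fun k _ => ?_)
  have hx := hpos k
  have hJ : |((∑ z ∈ Finset.Ioc ⌊phiForm δ k⌋ (⌊phiForm δ k⌋ + ⌊T * h28 a k⌋),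
      (torusN ((((z : ℝ) - phiForm δ k) / h28 a k) • sParam a + δ) -
        torusN ((((z : ℝ) - phiForm δ k) / h28 a k - r / 2) • sParam a + δ)) : ℤ) : ℝ)| ≤ T * h28 a k := by
    by_cases hk : k ∈ FIdx
    · obtain ⟨h1, h2⟩ := jumpMass_bounds_of_FIdx hpos hT hper hr hsep hk
      rw [abs_of_nonneg (by exact_mod_cast h1)]; exact h2
    · obtain ⟨h1, h2⟩ := jumpMass_bounds_of_not_FIdx hpos hT hper hr hsep hk
      rw [abs_of_nonpos (by exact_mod_cast h1)]; linarith
  rw [abs_mul, abs_div, abs_of_pos hx]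
  calc |phiForm Δ k| / h28 a k * _ ≤ |phiForm Δ k| / h28 a k * (T * h28 a k) :=
        mul_le_mul_of_nonneg_left hJ (by positivity)
    _ = T * |phiForm Δ k| := by field_simp

end Summit.KontsevichZagierPeriods.Zeta5Search.Barrier.ConeGamma

end
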